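import Summits.ValiantsHypothesis.ValiantsHypothesis.Theorems.GrenetZeonDualUnipotentThreeHalvesHeavyTopHalfSpeedSeam

/-!
# Inflated returns — the half-speed laws `HalfSpeedLaw` / `HalfSpeedIrrLaw` (LINE β `half_speed`, S⁺ / C⁺) are FALSE
# (val-idea-30 g2, crux `GrenetZeon.DualUnipotentThreeHalves` = stmt-ValiantsHypothesis-24318, residue R2 `HeavyTopLaw`)

WITNESS.  MOR 1991 §5 prints, for every `n > 3`, the irreducible TWO-dimensional nilpotent space `span{S, R_{n−2}}`; at `n = 4`
it is `span{J₄, R₂}`, `J₄ = E₁₂+E₂₃+E₃₄`, `R₂ = E₃₁ − E₄₂` (`(xJ₄ + yR₂)⁴ = 0`, ✓ `base_pow_four` below).  INFLATE it by MOR's own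
device (the one that turns `span{S₃, R₁}` into `𝓜_k`): `U₄ₖ := { J₄ ⊗ A + s·(R₂ ⊗ 1_k) : A ∈ M_k(ℂ), s ∈ ℂ } ⊂ M_{4k}(ℂ)`,
`dim U₄ₖ = k² + 1`.  Since `A` and `s·1` commute, `(J₄ ⊗ A + s R₂ ⊗ 1)⁴ = Σ_{a+b=4} c_{a,b}(J₄,R₂) ⊗ sᵇAᵃ = 0` (`c_{a,b}` = the
`xᵃyᵇ`-coefficient of `(xJ₄+yR₂)⁴ = 0`): a NILPOTENT space; it is IRREDUCIBLE (an invariant `W ∋ Σ_b e_b ⊗ w_b ≠ 0` contains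
`e₁ ⊗ A w_{b₀}` for all `A` via `J₄^{b₀−1} ⊗ A`, hence `e₁ ⊗ ℂᵏ`, hence — by `R₂ ⊗ 1`, `J₄ ⊗ A`, `R₂ ⊗ 1` — everything; Burnside check
`dim ℂ⟨U₄ₖ⟩ = (4k)²` done exactly for `k = 2, 3`).
KILLING WORD.  For `Q = J₄ ⊗ B ∈ T` and `P = R₂ ⊗ 1 ∈ U₄ₖ`: `(Q Q P)ʲ (e₁ ⊗ x) = ± e₁ ⊗ B²ʲ x`, so if `B` is NOT nilpotent the word
`(QQP)ʲ` is non-zero for every `j`, with `#Q = 2j > Θ + j = Θ + #P` as soon as `j > Θ`: `HalfSpeed Θ U₄ₖ T` forces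
`{B : J₄ ⊗ B ∈ T}` to be a linear space of NILPOTENT `k × k` matrices, of dimension `≤ k(k−1)/2` (Gerstenhaber, Literature
`finrank_le_choose_two`), whence `codim_{U₄ₖ} T ≥ k² − k(k−1)/2 = k(k+1)/2` FOR EVERY HEIGHT `Θ ≥ 1` (✗ `Θ·codim ≤ C·d² = 16Ck²` at
`Θ = d = 4k`, `k = 8C+1`).  Hence `¬ HalfSpeedIrrLaw` and (trivially) `¬ HalfSpeedLaw`.
R2 ITSELF IS NOT HIT: w.r.t. the block flag (levels 3,2,1,0 on the four `ℂᵏ`-blocks) every pair is word-tame with profile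
`(r, c, Θ) = (2, 1, 3)` (`#Q ≤ 3 + 2·#P`, climbing part `J₄ ⊗ M_k` of codimension ONE) — the inflations separate R2 from every
format-free law with BOUNDED drop/climb ratio (β's S⁺ has r = c = 1; so had this seat's g2 draft «hessenberg-defect», withdrawn).
More generally `U_{p,k} := J_p ⊗ M_k ⊕ ℂ·(E_{p−1,1} − E_{p,2}) ⊗ 1_k ⊂ M_{pk}` (inflating MOR's `span{S_p, R_{p−2}}`) forces ratio
`r/c ≥ p − 2` on every word-tame certificate whose `Q`-letter has a non-nilpotent `M_k`-part.

CONTENTS: `J4`, `R2`, ✓ `base_pow_four`; `inflMat`, `inflSpace`; STUBS (`sorry`; M-sized refuter targets): `stub_infl_nilpotent`,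
`stub_infl_irreducible`, `stub_infl_codim` (the killing word + Gerstenhaber); HEADS proved from the stubs: `not_halfSpeedIrrLaw`,
`not_halfSpeedLaw`.  HONEST LABEL: a refutation SKELETON — the two `¬` heads are kernel-checked modulo the three stubs; nothing here
bears on R2 / 24318 / 8062 except by killing a strengthening; `VP ≠ VNP` is NOT proved.  [val-idea-30 g2; MOR 1991 §5; Gerstenhaber 1958]
-/

noncomputable section

-- single-conjunct layout: Sub = Summit, duplicated namespace component intended
set_option linter.dupNamespace false
set_option autoImplicit false

namespace Summit.ValiantsHypothesis.ValiantsHypothesis.Cruxes.DualUnipotentThreeHalves.InflatedReturns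

open Matrix
open scoped Kronecker BigOperators
open Summit.ValiantsHypothesis.ValiantsHypothesis.Theorems.GrenetZeon.HalfSpeed

/-! ## §1 The printed base: MOR's two-dimensional irreducible space at `n = 4` -/

/-- `J₄ = E₁₂ + E₂₃ + E₃₄` (the shift `e₂ ↦ e₁, e₃ ↦ e₂, e₄ ↦ e₃`). -/
def J4 : Matrix (Fin 4) (Fin 4) ℂ := !![0, 1, 0, 0; 0, 0, 1, 0; 0, 0, 0, 1; 0, 0, 0, 0]

/-- `R₂ = E₃₁ − E₄₂` (MOR's depth-two return `e₁ ↦ e₃, e₂ ↦ −e₄`). -/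
def R2 : Matrix (Fin 4) (Fin 4) ℂ := !![0, 0, 0, 0; 0, 0, 0, 0; 1, 0, 0, 0; 0, -1, 0, 0]

/-- ✓ **`span{J₄, R₂}` is a nilpotent space**: `(xJ₄ + yR₂)⁴ = 0` identically (MOR 1991 §5, `n = 4`). -/
theorem base_pow_four (x y : ℂ) : (x • J4 + y • R2) ^ 4 = 0 := by
  ext i j
  fin_cases i <;> fin_cases j <;>
    simp [J4, R2, pow_succ, Matrix.mul_apply, Fin.sum_univ_four] <;>
    (first | ring1 | (left; ring1) | (left; left; ring1) | norm_num)

/-! ## §2 The inflation `U₄ₖ = J₄ ⊗ M_k ⊕ ℂ·(R₂ ⊗ 1)` -/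

/-- The inflated matrix `J₄ ⊗ A + s·(R₂ ⊗ 1_k)`, re-indexed to `Fin (4k)`. -/
def inflMat (k : ℕ) (A : Matrix (Fin k) (Fin k) ℂ) (s : ℂ) : Matrix (Fin (4 * k)) (Fin (4 * k)) ℂ :=
  Matrix.reindex finProdFinEquiv finProdFinEquiv
    (J4 ⊗ₖ A + s • (R2 ⊗ₖ (1 : Matrix (Fin k) (Fin k) ℂ)))

/-- **`U₄ₖ`** — the inflation space (`dim = k² + 1`). -/
def inflSpace (k : ℕ) : Submodule ℂ (Matrix (Fin (4 * k)) (Fin (4 * k)) ℂ) :=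
  Submodule.span ℂ (Set.range fun p : Matrix (Fin k) (Fin k) ℂ × ℂ => inflMat k p.1 p.2)

/-! ## §3 Stubs (the only `sorry`s; refuter / prover targets, each M-sized) -/

/-- STUB N (nilpotency): every member of `U₄ₖ` has fourth power `0` — expand `(J₄ ⊗ A + s R₂ ⊗ 1)⁴` by
`Matrix.mul_kronecker_mul`; the `M_k`-factor of a word with `a` letters `A` and `b` letters `s·1` is `sᵇAᵃ` whatever the order, and
the `J₄,R₂`-factor sums to the `xᵃyᵇ`-coefficient of `(xJ₄+yR₂)⁴ = 0` (✓ `base_pow_four`; five 4×4 identities). -/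
theorem stub_infl_nilpotent (k : ℕ) : ∀ A ∈ inflSpace k, IsNilpotent A := by
  sorry

/-- STUB I (irreducibility, `k ≥ 1`): see the file docstring (reach `e₁ ⊗ ℂᵏ` with `J₄^{b₀−1} ⊗ A`, then `R₂ ⊗ 1`, `J₄ ⊗ A`). -/
theorem stub_infl_irreducible (k : ℕ) (hk : 1 ≤ k) :
    ∀ V : Submodule ℂ (Fin (4 * k) → ℂ), (∀ A ∈ inflSpace k, ∀ x ∈ V, A *ᵥ x ∈ V) → V = ⊥ ∨ V = ⊤ := by
  sorry

/-- STUB W (the killing word + Gerstenhaber): a half-speed partner `T ≤ U₄ₖ` of ANY height has codimension `≥ k(k+1)/2`: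
`Q = J₄ ⊗ B ∈ T`, `P = R₂ ⊗ 1`: `(QQP)ʲ(e₁ ⊗ x) = ±e₁ ⊗ B²ʲx ≠ 0` for non-nilpotent `B` and `j = Θ + 1` violates `#Q ≤ Θ + #P`; so
`{B : J₄ ⊗ B ∈ T}` is a nilpotent space, `dim ≤ k(k−1)/2` (Literature ✓ `finrank_le_choose_two`), and `dim U₄ₖ = k² + 1`. -/
theorem stub_infl_codim (k Θ : ℕ) (T : Submodule ℂ (Matrix (Fin (4 * k)) (Fin (4 * k)) ℂ)) (hT : T ≤ inflSpace k)
    (h : HalfSpeed Θ (inflSpace k : Set (Matrix (Fin (4 * k)) (Fin (4 * k)) ℂ)) (T : Set (Matrix (Fin (4 * k)) (Fin (4 * k)) ℂ))) :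
    k * (k + 1) ≤ 2 * (Module.finrank ℂ (inflSpace k) - Module.finrank ℂ T) := by
  sorry

/-! ## §4 Heads (kernel-checked from the stubs; no `sorry` below this line) -/

/-- ★ **`HalfSpeedIrrLaw` is FALSE** (LINE β's C⁺ = `stub_halfSpeedIrrLaw` is unprovable): at `k = 8C + 1`, `d = Θ = 4k`. -/
theorem not_halfSpeedIrrLaw : ¬ HalfSpeedIrrLaw := by
  rintro ⟨C, hC⟩
  obtain ⟨k, hk⟩ : ∃ k : ℕ, k = 8 * C + 1 := ⟨_, rfl⟩
  have hk1 : 1 ≤ k := by omega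
  obtain ⟨T, hTU, hcod, hhs⟩ :=
    hC (4 * k) (inflSpace k) (stub_infl_nilpotent k) (stub_infl_irreducible k hk1) (4 * k) (by omega) le_rfl
  have h2 := stub_infl_codim k (4 * k) T hTU hhs
  generalize hF : Module.finrank ℂ (inflSpace k) - Module.finrank ℂ T = F at hcod h2
  have hR : C * (4 * k) ^ 2 = 2 * k * (k * (k - 1)) := by
    have e : k - 1 = 8 * C := by omega
    rw [e, hk]; ring
  have h3 : 2 * k * (k * (k + 1)) ≤ 2 * k * (k * (k - 1)) :=
    calc 2 * k * (k * (k + 1)) ≤ 2 * k * (2 * F) := Nat.mul_le_mul_left _ h2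
      _ = 4 * k * F := by ring
      _ ≤ C * (4 * k) ^ 2 := hcod
      _ = 2 * k * (k * (k - 1)) := hR
  have h4 : k * (k + 1) ≤ k * (k - 1) := Nat.le_of_mul_le_mul_left h3 (by omega)
  have h5 : k + 1 ≤ k - 1 := Nat.le_of_mul_le_mul_left h4 (by omega)
  omega

/-- `HalfSpeedLaw` trivially implies its restriction to irreducible spaces. -/
theorem halfSpeedIrrLaw_of_halfSpeedLaw (h : HalfSpeedLaw) : HalfSpeedIrrLaw := by
  obtain ⟨C, hC⟩ := h
  exact ⟨C, fun d U hU _ => hC d U hU⟩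

/-- ★ **`HalfSpeedLaw` (LINE β's S⁺) is FALSE.** -/
theorem not_halfSpeedLaw : ¬ HalfSpeedLaw := fun h => not_halfSpeedIrrLaw (halfSpeedIrrLaw_of_halfSpeedLaw h)

end Summit.ValiantsHypothesis.ValiantsHypothesis.Cruxes.DualUnipotentThreeHalves.InflatedReturns

end
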